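import Summits.QuantumFields.BalabanUV.T4Continuum.Support.NE7K1LinSchurLineForm
import Literature.MathematicalPhysics.QuantumFieldTheory.Balaban1983to89.Beta.CombesThomasFormOp

/-!
# NE7K1LinSchurLineSetDecay — row NE7 (node U5), candidate route HOM, path H1L, cell K1-lin(s): the `L²` (SET-TO-SET)
# Combes–Thomas bound for the interpolated-Schur propagator `G(s) = [(1−s)P₀ + s(A₁ − BD⁻¹C)]⁻¹`, UNIFORMLY IN `s ∈ [0,1]` —
# the abstract core of B4 Corollary 2.3 (2.30)'s FIRST PAIRING for the two-cutoff line

Lineage `b2b-balaban-t4-ne7-p2` (CRUX PROVER NE7 #2), generation 78; file 85.  NEEDS-ESTIMATE #E1, item (o3-Ω) of the desk's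
census (PRICING-NE7 v39 §285 ∕ v40 §291–§292: «a Cor. 2.3-type statement for the LINE on a non-box region»; closing rule «#E1
CLOSES when the box file is ✓ by tree sha AND (o3-Ω) is ✓ or shown unconsumed»).  This file is the ABSTRACT half: the U = 1
instance on every union of blocks is file 86 `NE7K1LinSchurLineU1Set`, the region layers (B4 Prop. 2.3 (1.13)–(1.18) for the
line on every finite union of `L_P`-blocks) are files 87–89.

THE POINT.  `NE7K1LinSchurLineForm.lineOpR_inv_decay_form` is ENTRYWISE (`|G(s)(x,y)| ≤ (2∕σ)e^{−(ρ(x)−ρ(y))}`); summed over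
two blocks of `n^{d+1}` fine points it loses a factor `n^{2(d+1)}`, useless for the unit-lattice operator
`Δ_s^{(j)} = aI − a²Q_nG(s)Q_n^*` on a general region.  What B4 §5 (5.4) ∕ Cor. 2.3 (2.30) consume is the `L²` bound
`‖1_S G 1_T‖_{ℓ²→ℓ²} ≤ (2∕σ)e^{−(lo − hi)}` (weight `≥ lo` on `S`, `≤ hi` on `T`).  For the LINE this is NOT a plain
Combes–Thomas statement (the Schur endpoint is non-local); it IS one for the √s-EXTENDED operator
`𝒫(s) = [[(1−s)P₀ + sA₁, √s·B],[√s·C, D]]` on coarse ⊕ fine (file `NE7K1LinSchurLineForm`: same coercivity floor, same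
conjugation-error bound for every `s ∈ [0,1]`), whose inverse has `G(s)` as its coarse–coarse block
(`inv_extOpR_inl_inl`).  So: solve `𝒫(s)v = (g, 0)` for a coarse source `g` supported in `T`; the coarse component of
`v` is `G(s)g` (`inv_extOpR_mulVec_inl`); `Beta.CombesThomasFormOp.setDecay_form_op` on `𝒫(s)` with the sets
`inl S`, `inl T` gives **`lineOpR_inv_setDecay_form`**:
`Σ_{i∈S}(G(s)g)_i² ≤ (2∕σ)²·e^{−2(lo−hi)}·Σ_j g_j²` — constant AND admissible weight class independent of `s`.

HONEST FRAMING: [folklore] (CombesThomas1973 §II in the tree's quadratic-form version, applied to one more finite matrix);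
abstract — no lattice, no Bałaban letter; nothing printed asserted; no `sorry`.  Census only; NE7 NOT PRINTED ∕ NOT PROVED;
spine 0∕9; FIXED FINITE T⁴, rung (B)+1; NOT infinite volume, NOT mass gap, NOT Clay.  HONEST DEPENDENCY: continuum YM on T⁴ ⇐
BetaPertH ∧ nine spine estimates (0/9 proved); BetaPertH ⇐ (D1) ∧ (D4) ∧ CAP+tail; G-an2-4 gates asym, D1 and NE2/3/4.
-/

noncomputable section

open Finset Matrix

namespace Summit.QuantumFields.BalabanUV.T4Continuum.NE7K1LinSchurLineSetDecay

open NE7K1LinSchurLineForm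
open Literature.MathematicalPhysics.QuantumFieldTheory.Balaban1983to89.Beta.CombesThomasFormOp (setDecay_form_op)

variable {ιc ιf : Type*} [Fintype ιc] [Fintype ιf] [DecidableEq ιc] [DecidableEq ιf]
variable (P₀ A₁ : Matrix ιc ιc ℝ) (B : Matrix ιc ιf ℝ) (C : Matrix ιf ιc ℝ) (D : Matrix ιf ιf ℝ)

/-! ### §1 Coarse sources: the coarse component of `𝒫(s)⁻¹(g, 0)` is `G(s)g` -/

/-- For a coarse-supported source `(g, 0)`, the coarse component of `𝒫(s)⁻¹(g,0)` is `G(s)g` — the block-inverse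
identity `inv_extOpR_inl_inl` read on vectors. [folklore] -/
theorem inv_extOpR_mulVec_inl {s : ℝ} (hs : 0 ≤ s) (hD : IsUnit D.det) (hS : IsUnit (lineOpR P₀ A₁ B C D s).det)
    (g : ιc → ℝ) (x : ιc) :
    ((extOpR P₀ A₁ B C D s)⁻¹.mulVec (Sum.elim g 0)) (Sum.inl x) = ((lineOpR P₀ A₁ B C D s)⁻¹.mulVec g) x := by
  simp only [Matrix.mulVec, dotProduct, Fintype.sum_sum_type, Sum.elim_inl, Sum.elim_inr, Pi.zero_apply, mul_zero,
    Finset.sum_const_zero, add_zero]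
  refine Finset.sum_congr rfl fun y _ => ?_
  rw [inv_extOpR_inl_inl P₀ A₁ B C D hs hD hS]

omit [Fintype ιc] [Fintype ιf] [DecidableEq ιc] [DecidableEq ιf] in
/-- `(g, 0)` vanishes off `inl T` when `g` vanishes off `T`. [folklore] -/
theorem elim_zero_of_not_mem_map {T : Finset ιc} (g : ιc → ℝ) (hg : ∀ j, j ∉ T → g j = 0) (j : ιc ⊕ ιf)
    (hj : j ∉ T.map ⟨Sum.inl, Sum.inl_injective⟩) : Sum.elim g 0 j = 0 := by
  rcases j with x | φ
  · simp only [Sum.elim_inl]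
    refine hg x fun hx => hj ?_
    exact Finset.mem_map.2 ⟨x, hx, rfl⟩
  · simp only [Sum.elim_inr, Pi.zero_apply]

omit [Fintype ιf] [DecidableEq ιc] [DecidableEq ιf] in
/-- `Σ_j (g,0)_j² = Σ_x g_x²`. [folklore] -/
theorem sum_sq_elim_zero [Fintype ιf] (g : ιc → ℝ) : ∑ j, (Sum.elim g (0 : ιf → ℝ)) j ^ 2 = ∑ x, g x ^ 2 := by
  simp only [Fintype.sum_sum_type, Sum.elim_inl, Sum.elim_inr, Pi.zero_apply]
  simp

/-! ### §2 THE `L²` SET-TO-SET BOUND FOR THE LINE, UNIFORMLY IN `s` -/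

/-- **K1-lin(s), `L²` SET-TO-SET VERSION — the abstract core of B4 Cor. 2.3 (2.30)'s first pairing for the two-cutoff
line.**  Let `P₀` and `H₁ = [[A₁,B],[C,D]]` be `σ`-coercive (`σ > 0`) and let the weight `ρ` on coarse ⊕ fine have
Combes–Thomas conjugation error `≥ −(σ∕2)‖·‖²` against `P₀` (restricted weight) and against `H₁`.  Then for EVERY
`s ∈ [0,1]`, every pair of coarse sets `S`, `T` with `ρ ∘ inl ≥ lo` on `S` and `ρ ∘ inl ≤ hi` on `T`, and every coarse
source `g` supported in `T`:  `Σ_{i∈S}(P(s)⁻¹g)_i² ≤ (2∕σ)²·e^{−2(lo−hi)}·Σ_j g_j²`, i.e.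
`‖1_S P(s)⁻¹ 1_T‖_{ℓ²→ℓ²} ≤ (2∕σ)e^{−(lo−hi)}` — the constant and the admissible weight class independent of `s`
(tree `Beta.CombesThomasFormOp.setDecay_form_op` on `𝒫(s)`, then the block inverse on vectors).  The first conjunct
records that `P(s)` is invertible. [folklore] -/
theorem lineOpR_inv_setDecay_form {σ : ℝ} (hσ : 0 < σ) (ρ : ιc ⊕ ιf → ℝ)
    (hP₀ : ∀ a : ιc → ℝ, σ * (a ⬝ᵥ a) ≤ a ⬝ᵥ P₀.mulVec a)
    (hH₁ : ∀ u : ιc ⊕ ιf → ℝ, σ * (u ⬝ᵥ u) ≤ u ⬝ᵥ (fromBlocks A₁ B C D).mulVec u)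
    (h₀ : ∀ a : ιc → ℝ, -(σ / 2) * (a ⬝ᵥ a) ≤
      ∑ j, ∑ k, (Real.exp (ρ (Sum.inl j) - ρ (Sum.inl k)) - 1) * P₀ j k * (a j * a k))
    (h₁ : ∀ u : ιc ⊕ ιf → ℝ, -(σ / 2) * (u ⬝ᵥ u) ≤
      ∑ j, ∑ k, (Real.exp (ρ j - ρ k) - 1) * (fromBlocks A₁ B C D) j k * (u j * u k))
    {s : ℝ} (hs0 : 0 ≤ s) (hs1 : s ≤ 1)
    (S T : Finset ιc) (lo hi : ℝ) (hlo : ∀ i ∈ S, lo ≤ ρ (Sum.inl i)) (hhi : ∀ j ∈ T, ρ (Sum.inl j) ≤ hi)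
    (g : ιc → ℝ) (hg : ∀ j, j ∉ T → g j = 0) :
    IsUnit (lineOpR P₀ A₁ B C D s).det ∧
      ∑ i ∈ S, ((lineOpR P₀ A₁ B C D s)⁻¹.mulVec g) i ^ 2 ≤
        (2 / σ) ^ 2 * Real.exp (-(2 * (lo - hi))) * ∑ j, g j ^ 2 := by
  have hposE := coercive_extOpR P₀ A₁ B C D hP₀ hH₁ hs0 hs1
  have herrE := conjError_extOpR_ge P₀ A₁ B C D ρ h₀ h₁ hs0 hs1
  have hdetE : IsUnit (extOpR P₀ A₁ B C D s).det := isUnit_det_of_coercive _ hσ hposE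
  have hD : IsUnit D.det := isUnit_det_fineR A₁ B C D hσ hH₁
  have hL : IsUnit (lineOpR P₀ A₁ B C D s).det := isUnit_det_lineOpR_of_extOpR P₀ A₁ B C D hs0 hD hdetE
  refine ⟨hL, ?_⟩
  set gh : ιc ⊕ ιf → ℝ := Sum.elim g 0 with hgh
  set v : ιc ⊕ ιf → ℝ := (extOpR P₀ A₁ B C D s)⁻¹.mulVec gh with hvdef
  have hv : (extOpR P₀ A₁ B C D s).mulVec v = gh := by
    rw [hvdef, Matrix.mulVec_mulVec, Matrix.mul_nonsing_inv _ hdetE, Matrix.one_mulVec]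
  have h := setDecay_form_op (extOpR P₀ A₁ B C D s) σ ρ hσ hposE herrE
    (S.map ⟨Sum.inl, Sum.inl_injective⟩) (T.map ⟨Sum.inl, Sum.inl_injective⟩) lo hi
    (fun i hi' => ?_) (fun j hj' => ?_) gh v (fun j hj => elim_zero_of_not_mem_map g hg j hj) hv
  · have hS : ∑ i ∈ S, ((lineOpR P₀ A₁ B C D s)⁻¹.mulVec g) i ^ 2 =
        ∑ i ∈ S.map ⟨Sum.inl, Sum.inl_injective⟩, v i ^ 2 := by
      rw [Finset.sum_map]
      refine Finset.sum_congr rfl fun x _ => ?_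
      simp only [Function.Embedding.coeFn_mk]
      rw [hvdef, hgh, inv_extOpR_mulVec_inl P₀ A₁ B C D hs0 hD hL g x]
    rw [hS, ← sum_sq_elim_zero (ιf := ιf) g]
    exact h
  · obtain ⟨x, hx, rfl⟩ := Finset.mem_map.1 hi'
    exact hlo x hx
  · obtain ⟨x, hx, rfl⟩ := Finset.mem_map.1 hj'
    exact hhi x hx

/-- **PAIRING FORM** (Cauchy–Schwarz read-out): under the same hypotheses, for `f` supported in `S` and `g` supported in
`T`, `|⟨f, P(s)⁻¹g⟩|² ≤ (2∕σ)²·e^{−2(lo−hi)}·(Σf²)(Σg²)` — B4 (2.30)'s first pairing for the line, abstract form.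
[folklore] -/
theorem lineOpR_inv_pairing_sq_le {σ : ℝ} (hσ : 0 < σ) (ρ : ιc ⊕ ιf → ℝ)
    (hP₀ : ∀ a : ιc → ℝ, σ * (a ⬝ᵥ a) ≤ a ⬝ᵥ P₀.mulVec a)
    (hH₁ : ∀ u : ιc ⊕ ιf → ℝ, σ * (u ⬝ᵥ u) ≤ u ⬝ᵥ (fromBlocks A₁ B C D).mulVec u)
    (h₀ : ∀ a : ιc → ℝ, -(σ / 2) * (a ⬝ᵥ a) ≤
      ∑ j, ∑ k, (Real.exp (ρ (Sum.inl j) - ρ (Sum.inl k)) - 1) * P₀ j k * (a j * a k))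
    (h₁ : ∀ u : ιc ⊕ ιf → ℝ, -(σ / 2) * (u ⬝ᵥ u) ≤
      ∑ j, ∑ k, (Real.exp (ρ j - ρ k) - 1) * (fromBlocks A₁ B C D) j k * (u j * u k))
    {s : ℝ} (hs0 : 0 ≤ s) (hs1 : s ≤ 1)
    (S T : Finset ιc) (lo hi : ℝ) (hlo : ∀ i ∈ S, lo ≤ ρ (Sum.inl i)) (hhi : ∀ j ∈ T, ρ (Sum.inl j) ≤ hi)
    (f g : ιc → ℝ) (hf : ∀ i, i ∉ S → f i = 0) (hg : ∀ j, j ∉ T → g j = 0) :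
    (f ⬝ᵥ (lineOpR P₀ A₁ B C D s)⁻¹.mulVec g) ^ 2 ≤
      (2 / σ) ^ 2 * Real.exp (-(2 * (lo - hi))) * (∑ i, f i ^ 2) * (∑ j, g j ^ 2) := by
  set X := (lineOpR P₀ A₁ B C D s)⁻¹.mulVec g with hX
  have hmain := (lineOpR_inv_setDecay_form P₀ A₁ B C D hσ ρ hP₀ hH₁ h₀ h₁ hs0 hs1 S T lo hi hlo hhi g hg).2
  -- `⟨f, X⟩ = Σ_{i∈S} f_i X_i` and Cauchy–Schwarz on `S`
  have hdot : f ⬝ᵥ X = ∑ i ∈ S, f i * X i := by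
    unfold dotProduct
    rw [← Finset.sum_subset (Finset.subset_univ S)]
    intro i _ hi
    rw [hf i hi, zero_mul]
  have hCS : (∑ i ∈ S, f i * X i) ^ 2 ≤ (∑ i ∈ S, f i ^ 2) * (∑ i ∈ S, X i ^ 2) :=
    Finset.sum_mul_sq_le_sq_mul_sq S f X
  have hfS : ∑ i ∈ S, f i ^ 2 ≤ ∑ i, f i ^ 2 :=
    Finset.sum_le_sum_of_subset_of_nonneg (Finset.subset_univ S) fun i _ _ => sq_nonneg _
  have hf0 : 0 ≤ ∑ i, f i ^ 2 := Finset.sum_nonneg fun i _ => sq_nonneg _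
  have hXS : 0 ≤ ∑ i ∈ S, X i ^ 2 := Finset.sum_nonneg fun i _ => sq_nonneg _
  rw [hdot]
  calc (∑ i ∈ S, f i * X i) ^ 2 ≤ (∑ i ∈ S, f i ^ 2) * (∑ i ∈ S, X i ^ 2) := hCS
    _ ≤ (∑ i, f i ^ 2) * ((2 / σ) ^ 2 * Real.exp (-(2 * (lo - hi))) * ∑ j, g j ^ 2) :=
        mul_le_mul hfS hmain hXS hf0
    _ = (2 / σ) ^ 2 * Real.exp (-(2 * (lo - hi))) * (∑ i, f i ^ 2) * (∑ j, g j ^ 2) := by ring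

end Summit.QuantumFields.BalabanUV.T4Continuum.NE7K1LinSchurLineSetDecay
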